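import Summits.ResolutionOfSingularities.ResolutionOfSingularities.Theorems.EquisingularLiftEquisingularLiftNatKummerHinges
import Literature.AlgebraicGeometry.Resolution.BlowupAlgebraQuasiRegularChart
import Literature.AlgebraicGeometry.Resolution.RegularQuotientIdeal
import Literature.AlgebraicGeometry.Resolution.AdicCompletionRegular
import Mathlib.RingTheory.Localization.Away.Basic
import Mathlib.RingTheory.Localization.AtPrime.Basic
import Mathlib.RingTheory.Localization.Ideal
import HarnessLib

/-!
# The strict transform of a colliding section (crux `EquisingularLift`, honest variant EL♮ = `EquisingularLiftNat`,
# stmt-ResolutionOfSingularities-20038; idea card 1 `unscrew-split-orbits`, step (b))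

[OURS · L W4.5 (b)] Helper for the idea card 1 `unscrew-split-orbits` of `res-L1-w45b-idea-2` (`Cruxes/EquisingularLift/Ideas/`,
Sketch `HOME/L/res-L1-w45b-idea-2/Sketch-L1-idea-2.lean` v5 l. 78, decl `StrictTransformOfSection`, VERBATIM). NOT a statement of
the manuscript under review (Hironaka 2017); nothing here is attributed to its author. Pure commutative algebra over the tree's
affine blowup algebra `S = R[𝔭/x] ⊆ R[1/x]` (`Literature.AlgebraicGeometry.Resolution.blowupAlgebra`); `𝔮'` = the strict transform
of the section ideal `𝔮` = kernel of `S → (R/𝔮)[1/x̄]`.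
**Proof.** With `ψ : R[1/x] → (R/𝔮)[1/x̄]` the localised reduction and `ι : R → (R/𝔮)[1/x̄]` (injective modulo `𝔮`; the target is
a domain): every generator `p/x` of `S` (`p = q + ax ∈ 𝔭 ⊆ 𝔮 + (x)`) has `ψ(p/x) = ι(a)`, so `ψ(S) = ι(R)` — whence `𝔮' ∩ R = 𝔮`,
`R ↠ S/𝔮'`, and `S/(𝔮' + (ϖ)) ≅ R/𝔪` (maximality). `𝔮' + (x) = 𝔮' + (ϖᶜ)` is `𝔭 + 𝔮 = 𝔮 + (ϖᶜ)` read in `S` (`𝔭S = xS`,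
`𝔮 ⊆ 𝔮'`). Regularity: `R/𝔭` is a DVR, so `𝔭` is cut out by a quasi-regular sequence `f` extracted from `{x} ∪ (𝔭 ∩ 𝔮)` (tree
`exists_isQuasiRegular_span_eq_of_isRegularLocalRing_quotient`); section ideals being incomparable (`eq_of_le_of_section`), `x` is
one of the `fᵢ`, and `R[(f)/fᵢ]` is a regular ring (tree `isRegularRing_blowupAlgebra`, Liu 8.1.19 (a)). Finally `ϖ ∉ 𝔪²` in
`S_{𝔮'+(ϖ)}` by `SectionForcesGoodPoint` for the section `𝔮' S_{𝔮'+(ϖ)}` (`ϖ ∉ 𝔮' S_{𝔮'+(ϖ)}` as `ψ(ϖ) = ι(ϖ) ≠ 0`).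
-/

set_option linter.dupNamespace false

noncomputable section
namespace Summit.ResolutionOfSingularities.ResolutionOfSingularities.Theorems.EquisingularLift.RamifiedCoalescence

open IsLocalRing Literature.AlgebraicGeometry.Resolution

universe u

/-! ## Generalities -/

/-- The localised reduction map `R[1/x] → (R/𝔮)[1/x̄]` on elements of `R`. OURS (Mathlib `IsLocalization.map_eq`). -/
theorem awayMap_algebraMap {R : Type*} [CommRing R] (𝔮 : Ideal R) (x r : R) :
    Localization.awayMap (Ideal.Quotient.mk 𝔮) x (algebraMap R (Localization.Away x) r) =
      algebraMap (R ⧸ 𝔮) (Localization.Away (Ideal.Quotient.mk 𝔮 x)) (Ideal.Quotient.mk 𝔮 r) := by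
  simp [Localization.awayMap, IsLocalization.Away.map, IsLocalization.map_eq]

/-- For a prime `𝔮` and `x ∉ 𝔮`, `(R/𝔮)[1/x̄]` is a domain into which `R/𝔮` embeds. OURS. -/
theorem isDomain_away_quotient {R : Type*} [CommRing R] (𝔮 : Ideal R) [𝔮.IsPrime] {x : R} (hx : x ∉ 𝔮) :
    IsDomain (Localization.Away (Ideal.Quotient.mk 𝔮 x)) ∧
      Function.Injective (algebraMap (R ⧸ 𝔮) (Localization.Away (Ideal.Quotient.mk 𝔮 x))) := by
  have hx0 : Ideal.Quotient.mk 𝔮 x ≠ 0 := by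
    rwa [Ne, Ideal.Quotient.eq_zero_iff_mem]
  have hle : Submonoid.powers (Ideal.Quotient.mk 𝔮 x) ≤ nonZeroDivisors (R ⧸ 𝔮) :=
    powers_le_nonZeroDivisors_of_noZeroDivisors hx0
  exact ⟨IsLocalization.isDomain_localization hle, IsLocalization.injective _ hle⟩

/-! ## The chart `S = R[𝔭/x]`, the localised reduction `ψ : R[1/x] → (R/𝔮)[1/x̄]` and `ι : R → (R/𝔮)[1/x̄]` -/

section Chart

variable {R : Type*} [CommRing R] {ϖ x : R} {𝔭 𝔮 : Ideal R}

/-- Membership in the strict transform `𝔮' = ker (S → (R/𝔮)[1/x̄])` is vanishing of the localised reduction. OURS. -/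
theorem mem_strictTransform_iff (s : blowupAlgebra 𝔭 x) :
    s ∈ RingHom.ker ((Localization.awayMap (Ideal.Quotient.mk 𝔮) x).comp (blowupAlgebra 𝔭 x).val.toRingHom) ↔
      Localization.awayMap (Ideal.Quotient.mk 𝔮) x s.val = 0 := by
  rw [RingHom.mem_ker]; rfl

/-- Scalars from `𝔭` lie in the exceptional ideal `(x) ⊆ S`: `p = x · (p/x)`. OURS. -/
theorem algebraMap_mem_span_of_mem {p : R} (hp : p ∈ 𝔭) :
    algebraMap R (blowupAlgebra 𝔭 x) p ∈ Ideal.span {algebraMap R (blowupAlgebra 𝔭 x) x} := by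
  refine Ideal.mem_span_singleton'.mpr
    ⟨⟨algebraMap R (Localization.Away x) p * IsLocalization.Away.invSelf x, div_mem_blowupAlgebra 𝔭 x hp⟩,
      Subtype.ext ?_⟩
  change algebraMap R (Localization.Away x) p * IsLocalization.Away.invSelf x * algebraMap R (Localization.Away x) x =
    algebraMap R (Localization.Away x) p
  exact div_mul_algebraMap _ _

variable [𝔮.IsPrime]

/-- `ι r₁ = ι r₂ ↔ r₁ ≡ r₂ (mod 𝔮)` for `ι : R → R/𝔮 → (R/𝔮)[1/x̄]`, `x ∉ 𝔮`. OURS. -/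
theorem iota_eq_iff (hx𝔮 : x ∉ 𝔮) (r₁ r₂ : R) :
    algebraMap (R ⧸ 𝔮) (Localization.Away (Ideal.Quotient.mk 𝔮 x)) (Ideal.Quotient.mk 𝔮 r₁) =
      algebraMap (R ⧸ 𝔮) (Localization.Away (Ideal.Quotient.mk 𝔮 x)) (Ideal.Quotient.mk 𝔮 r₂) ↔ r₁ - r₂ ∈ 𝔮 := by
  rw [(isDomain_away_quotient 𝔮 hx𝔮).2.eq_iff, Ideal.Quotient.eq]

/-- `ι r = 0 ↔ r ∈ 𝔮`. OURS. -/
theorem iota_eq_zero_iff (hx𝔮 : x ∉ 𝔮) (r : R) :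
    algebraMap (R ⧸ 𝔮) (Localization.Away (Ideal.Quotient.mk 𝔮 x)) (Ideal.Quotient.mk 𝔮 r) = 0 ↔ r ∈ 𝔮 := by
  simpa using iota_eq_iff hx𝔮 r 0

/-- **`ψ(S) = ι(R)`**: every element of the chart `R[𝔭/x]` reduces, in `(R/𝔮)[1/x̄]`, to the class of a scalar — because a
generator `p/x`, `p = q + ax ∈ 𝔭 ⊆ 𝔮 + (x)`, reduces to `ā`. OURS. -/
theorem exists_awayMap_eq_of_mem_blowupAlgebra (h𝔭le : 𝔭 ≤ 𝔮 ⊔ Ideal.span {x}) (hx𝔮 : x ∉ 𝔮)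
    {y : Localization.Away x} (hy : y ∈ blowupAlgebra 𝔭 x) :
    ∃ r : R, Localization.awayMap (Ideal.Quotient.mk 𝔮) x y =
      algebraMap (R ⧸ 𝔮) (Localization.Away (Ideal.Quotient.mk 𝔮 x)) (Ideal.Quotient.mk 𝔮 r) := by
  have hψ := awayMap_algebraMap 𝔮 x
  have hιx : IsUnit (algebraMap (R ⧸ 𝔮) (Localization.Away (Ideal.Quotient.mk 𝔮 x)) (Ideal.Quotient.mk 𝔮 x)) :=
    IsLocalization.Away.algebraMap_isUnit _
  refine Algebra.adjoin_induction ?_ ?_ ?_ ?_ hy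
  · rintro _ ⟨p, hp, rfl⟩
    obtain ⟨q, hq, a, hqa⟩ : ∃ q ∈ 𝔮, ∃ a, q + a * x = p := by
      have := h𝔭le hp
      rw [Submodule.mem_sup] at this
      obtain ⟨q, hq, y, hy, rfl⟩ := this
      obtain ⟨a, rfl⟩ := Ideal.mem_span_singleton'.mp hy
      exact ⟨q, hq, a, rfl⟩
    refine ⟨a, hιx.mul_left_injective ?_⟩
    change Localization.awayMap (Ideal.Quotient.mk 𝔮) x (algebraMap R _ p * IsLocalization.Away.invSelf x) * _ = _ * _
    calc Localization.awayMap (Ideal.Quotient.mk 𝔮) x (algebraMap R _ p * IsLocalization.Away.invSelf x) *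
          algebraMap (R ⧸ 𝔮) (Localization.Away (Ideal.Quotient.mk 𝔮 x)) (Ideal.Quotient.mk 𝔮 x)
        = Localization.awayMap (Ideal.Quotient.mk 𝔮) x
            (algebraMap R _ p * IsLocalization.Away.invSelf x * algebraMap R (Localization.Away x) x) := by
          rw [← hψ x, ← map_mul]
      _ = algebraMap (R ⧸ 𝔮) (Localization.Away (Ideal.Quotient.mk 𝔮 x)) (Ideal.Quotient.mk 𝔮 (q + a * x)) := by
          rw [div_mul_algebraMap, hψ p, hqa]
      _ = _ := by
          simp only [map_add, map_mul, (iota_eq_zero_iff hx𝔮 q).mpr hq, zero_add]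
  · exact fun r => ⟨r, hψ r⟩
  · rintro y₁ y₂ - - ⟨r₁, h₁⟩ ⟨r₂, h₂⟩
    exact ⟨r₁ + r₂, by rw [map_add, h₁, h₂, map_add, map_add]⟩
  · rintro y₁ y₂ - - ⟨r₁, h₁⟩ ⟨r₂, h₂⟩
    exact ⟨r₁ * r₂, by rw [map_mul, h₁, h₂, map_mul, map_mul]⟩

/-- Scalars from `𝔮` lie in the strict transform. OURS. -/
theorem algebraMap_mem_strictTransform (hx𝔮 : x ∉ 𝔮) {q : R} (hq : q ∈ 𝔮) :
    algebraMap R (blowupAlgebra 𝔭 x) q ∈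
      RingHom.ker ((Localization.awayMap (Ideal.Quotient.mk 𝔮) x).comp (blowupAlgebra 𝔭 x).val.toRingHom) := by
  rw [mem_strictTransform_iff]
  change Localization.awayMap (Ideal.Quotient.mk 𝔮) x (algebraMap R (Localization.Away x) q) = 0
  rw [awayMap_algebraMap, iota_eq_zero_iff hx𝔮]
  exact hq

/-- **Conjunct 1: `𝔮' ∩ R = 𝔮`.** OURS. -/
theorem comap_strictTransform (hx𝔮 : x ∉ 𝔮) :
    Ideal.comap (algebraMap R (blowupAlgebra 𝔭 x))
      (RingHom.ker ((Localization.awayMap (Ideal.Quotient.mk 𝔮) x).comp (blowupAlgebra 𝔭 x).val.toRingHom)) = 𝔮 := by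
  ext r
  rw [Ideal.mem_comap, mem_strictTransform_iff]
  change Localization.awayMap (Ideal.Quotient.mk 𝔮) x (algebraMap R (Localization.Away x) r) = 0 ↔ _
  rw [awayMap_algebraMap, iota_eq_zero_iff hx𝔮]

/-- **Conjunct 2: `R → S/𝔮'` is onto** (so `S/𝔮' ≅ R/𝔮`). OURS. -/
theorem surjective_quotient_strictTransform (h𝔭le : 𝔭 ≤ 𝔮 ⊔ Ideal.span {x}) (hx𝔮 : x ∉ 𝔮) :
    Function.Surjective (fun r : R => Ideal.Quotient.mk
      (RingHom.ker ((Localization.awayMap (Ideal.Quotient.mk 𝔮) x).comp (blowupAlgebra 𝔭 x).val.toRingHom))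
      (algebraMap R (blowupAlgebra 𝔭 x) r)) := by
  intro z
  obtain ⟨s, rfl⟩ := Ideal.Quotient.mk_surjective z
  obtain ⟨r, hr⟩ := exists_awayMap_eq_of_mem_blowupAlgebra h𝔭le hx𝔮 s.prop
  refine ⟨r, Ideal.Quotient.eq.mpr ?_⟩
  rw [mem_strictTransform_iff]
  change Localization.awayMap (Ideal.Quotient.mk 𝔮) x (algebraMap R (Localization.Away x) r - s.val) = 0
  rw [map_sub, awayMap_algebraMap, hr, sub_self]

/-- **Conjunct 3: the exceptional relation `𝔮' + (x) = 𝔮' + (ϖᶜ)`** — `𝔭 + 𝔮 = 𝔮 + (ϖᶜ)` read in `S`, where `𝔭S = xS`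
and `𝔮 ⊆ 𝔮'`. OURS. -/
theorem strictTransform_sup_span_eq (hx𝔮 : x ∉ 𝔮) (hx𝔭 : x ∈ 𝔭) (c : ℕ)
    (hcontact : 𝔭 ⊔ 𝔮 = 𝔮 ⊔ Ideal.span {ϖ ^ c}) :
    RingHom.ker ((Localization.awayMap (Ideal.Quotient.mk 𝔮) x).comp (blowupAlgebra 𝔭 x).val.toRingHom) ⊔
        Ideal.span {algebraMap R (blowupAlgebra 𝔭 x) x} =
      RingHom.ker ((Localization.awayMap (Ideal.Quotient.mk 𝔮) x).comp (blowupAlgebra 𝔭 x).val.toRingHom) ⊔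
        Ideal.span {algebraMap R (blowupAlgebra 𝔭 x) ϖ ^ c} := by
  apply le_antisymm
  · refine sup_le le_sup_left ((Ideal.span_singleton_le_iff_mem _).mpr ?_)
    have : x ∈ 𝔮 ⊔ Ideal.span {ϖ ^ c} := by
      rw [← hcontact]; exact Ideal.mem_sup_left hx𝔭
    rw [Submodule.mem_sup] at this
    obtain ⟨q, hq, y, hy, hqy⟩ := this
    obtain ⟨b, rfl⟩ := Ideal.mem_span_singleton'.mp hy
    have hx' : algebraMap R (blowupAlgebra 𝔭 x) x =
        algebraMap R (blowupAlgebra 𝔭 x) q + algebraMap R (blowupAlgebra 𝔭 x) b * algebraMap R (blowupAlgebra 𝔭 x) ϖ ^ c := by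
      rw [← map_pow, ← map_mul, ← map_add, hqy]
    rw [hx']
    exact Ideal.add_mem _ (Ideal.mem_sup_left (algebraMap_mem_strictTransform hx𝔮 hq))
      (Ideal.mem_sup_right (Ideal.mul_mem_left _ _ (Ideal.mem_span_singleton_self _)))
  · refine sup_le le_sup_left ((Ideal.span_singleton_le_iff_mem _).mpr ?_)
    have : ϖ ^ c ∈ 𝔭 ⊔ 𝔮 := by
      rw [hcontact]; exact Ideal.mem_sup_right (Ideal.mem_span_singleton_self _)
    rw [Submodule.mem_sup] at this
    obtain ⟨p, hp, q, hq, hpq⟩ := this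
    rw [← map_pow, ← hpq, map_add]
    exact Ideal.add_mem _ (Ideal.mem_sup_right (algebraMap_mem_span_of_mem hp))
      (Ideal.mem_sup_left (algebraMap_mem_strictTransform hx𝔮 hq))

/-- `1 ∉ 𝔮' + (ϖ)`: otherwise `ι(rϖ) = 1` for some `r`, i.e. `rϖ ≡ 1 (mod 𝔮)`, and `1 ∈ 𝔮 + (ϖ) = 𝔪`. OURS. -/
theorem one_notMem_strictTransform_sup [IsLocalRing R] (h𝔭le : 𝔭 ≤ 𝔮 ⊔ Ideal.span {x}) (hx𝔮 : x ∉ 𝔮)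
    (hϖm : ϖ ∈ maximalIdeal R) (h𝔮m : 𝔮 ≤ maximalIdeal R) :
    (1 : blowupAlgebra 𝔭 x) ∉
      RingHom.ker ((Localization.awayMap (Ideal.Quotient.mk 𝔮) x).comp (blowupAlgebra 𝔭 x).val.toRingHom) ⊔
        Ideal.span {algebraMap R (blowupAlgebra 𝔭 x) ϖ} := by
  intro h1
  rw [Submodule.mem_sup] at h1
  obtain ⟨k, hk, t, ht, hkt⟩ := h1
  obtain ⟨s, rfl⟩ := Ideal.mem_span_singleton'.mp ht
  obtain ⟨r, hr⟩ := exists_awayMap_eq_of_mem_blowupAlgebra h𝔭le hx𝔮 s.prop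
  have hk0 := (mem_strictTransform_iff k).mp hk
  have happ := congrArg (fun u : blowupAlgebra 𝔭 x => Localization.awayMap (Ideal.Quotient.mk 𝔮) x u.val) hkt
  change Localization.awayMap (Ideal.Quotient.mk 𝔮) x (k.val + s.val * algebraMap R (Localization.Away x) ϖ) =
    Localization.awayMap (Ideal.Quotient.mk 𝔮) x 1 at happ
  rw [map_add, map_mul, map_one, hk0, zero_add, hr, awayMap_algebraMap] at happ
  have h1 : algebraMap (R ⧸ 𝔮) (Localization.Away (Ideal.Quotient.mk 𝔮 x)) (Ideal.Quotient.mk 𝔮 (r * ϖ)) =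
      algebraMap (R ⧸ 𝔮) (Localization.Away (Ideal.Quotient.mk 𝔮 x)) (Ideal.Quotient.mk 𝔮 1) := by
    rw [map_mul, map_mul, happ, map_one, map_one]
  have h' : r * ϖ - 1 ∈ 𝔮 := (iota_eq_iff hx𝔮 _ _).mp h1
  have : (1 : R) ∈ maximalIdeal R := by
    rw [show (1 : R) = r * ϖ - (r * ϖ - 1) by ring]
    exact Ideal.sub_mem _ (Ideal.mul_mem_left _ r hϖm) (h𝔮m h')
  exact (maximalIdeal.isMaximal R).ne_top ((Ideal.eq_top_iff_one _).mpr this)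

/-- **Conjunct 4 (a): `𝔮' + (ϖ)` is a maximal ideal of `S`** — `R → S/(𝔮' + (ϖ))` is onto with kernel `𝔪`. OURS. -/
theorem isMaximal_strictTransform_sup [IsLocalRing R] (h𝔭le : 𝔭 ≤ 𝔮 ⊔ Ideal.span {x}) (hx𝔮 : x ∉ 𝔮)
    (hϖm : ϖ ∈ maximalIdeal R) (h𝔮m : 𝔮 ⊔ Ideal.span {ϖ} = maximalIdeal R) :
    (RingHom.ker ((Localization.awayMap (Ideal.Quotient.mk 𝔮) x).comp (blowupAlgebra 𝔭 x).val.toRingHom) ⊔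
        Ideal.span {algebraMap R (blowupAlgebra 𝔭 x) ϖ}).IsMaximal := by
  set M := RingHom.ker ((Localization.awayMap (Ideal.Quotient.mk 𝔮) x).comp (blowupAlgebra 𝔭 x).val.toRingHom) ⊔
        Ideal.span {algebraMap R (blowupAlgebra 𝔭 x) ϖ} with hM
  have h𝔮m' : 𝔮 ≤ maximalIdeal R := by rw [← h𝔮m]; exact le_sup_left
  have h1M : (1 : blowupAlgebra 𝔭 x) ∉ M := one_notMem_strictTransform_sup h𝔭le hx𝔮 hϖm h𝔮m'
  let g : R →+* blowupAlgebra 𝔭 x ⧸ M := (Ideal.Quotient.mk M).comp (algebraMap R (blowupAlgebra 𝔭 x))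
  have hgsurj : Function.Surjective g := by
    intro z
    obtain ⟨s, rfl⟩ := Ideal.Quotient.mk_surjective z
    obtain ⟨r, hr⟩ := surjective_quotient_strictTransform h𝔭le hx𝔮 (Ideal.Quotient.mk _ s)
    refine ⟨r, ?_⟩
    have hr' := Ideal.Quotient.eq.mp hr
    exact Ideal.Quotient.eq.mpr (Ideal.mem_sup_left hr')
  have hgker : RingHom.ker g = maximalIdeal R := by
    symm
    refine (maximalIdeal.isMaximal R).eq_of_le ?_ ?_
    · haveI : Nontrivial (blowupAlgebra 𝔭 x ⧸ M) :=
        Ideal.Quotient.nontrivial_iff.mpr fun h => h1M (h ▸ Submodule.mem_top)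
      exact RingHom.ker_ne_top g
    · rw [← h𝔮m]
      refine sup_le ?_ ((Ideal.span_singleton_le_iff_mem _).mpr ?_)
      · intro q hq
        rw [RingHom.mem_ker]
        change Ideal.Quotient.mk M (algebraMap R _ q) = 0
        rw [Ideal.Quotient.eq_zero_iff_mem]
        exact Ideal.mem_sup_left (algebraMap_mem_strictTransform hx𝔮 hq)
      · rw [RingHom.mem_ker]
        change Ideal.Quotient.mk M (algebraMap R _ ϖ) = 0
        rw [Ideal.Quotient.eq_zero_iff_mem]
        exact Ideal.mem_sup_right (Ideal.mem_span_singleton_self _)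
  apply Ideal.Quotient.maximal_of_isField
  have eqv : R ⧸ maximalIdeal R ≃+* blowupAlgebra 𝔭 x ⧸ M :=
    (Ideal.quotEquivOfEq hgker.symm).trans (RingHom.quotientKerEquivOfSurjective hgsurj)
  have hF : IsField (R ⧸ maximalIdeal R) :=
    (Ideal.Quotient.maximal_ideal_iff_isField_quotient _).mp inferInstance
  exact MulEquiv.isField hF eqv.symm.toMulEquiv

/-- `ϖ ∉ 𝔮' S_M` at `M = 𝔮' + (ϖ)`: a denominator `m ∉ M` with `mϖ ∈ 𝔮'` would give `ψ(m)·ι(ϖ) = 0` in the domain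
`(R/𝔮)[1/x̄]` with `ι(ϖ) ≠ 0`. OURS. -/
theorem algebraMap_notMem_map_strictTransform (hx𝔮 : x ∉ 𝔮) (hϖ𝔮 : ϖ ∉ 𝔮)
    [(RingHom.ker ((Localization.awayMap (Ideal.Quotient.mk 𝔮) x).comp (blowupAlgebra 𝔭 x).val.toRingHom) ⊔
        Ideal.span {algebraMap R (blowupAlgebra 𝔭 x) ϖ}).IsPrime] :
    algebraMap (blowupAlgebra 𝔭 x) (Localization.AtPrime
        (RingHom.ker ((Localization.awayMap (Ideal.Quotient.mk 𝔮) x).comp (blowupAlgebra 𝔭 x).val.toRingHom) ⊔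
          Ideal.span {algebraMap R (blowupAlgebra 𝔭 x) ϖ})) (algebraMap R (blowupAlgebra 𝔭 x) ϖ) ∉
      (RingHom.ker ((Localization.awayMap (Ideal.Quotient.mk 𝔮) x).comp (blowupAlgebra 𝔭 x).val.toRingHom)).map
        (algebraMap (blowupAlgebra 𝔭 x) (Localization.AtPrime
          (RingHom.ker ((Localization.awayMap (Ideal.Quotient.mk 𝔮) x).comp (blowupAlgebra 𝔭 x).val.toRingHom) ⊔
            Ideal.span {algebraMap R (blowupAlgebra 𝔭 x) ϖ}))) := by
  set 𝔮' := RingHom.ker ((Localization.awayMap (Ideal.Quotient.mk 𝔮) x).comp (blowupAlgebra 𝔭 x).val.toRingHom)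
    with h𝔮'
  set M := 𝔮' ⊔ Ideal.span {algebraMap R (blowupAlgebra 𝔭 x) ϖ} with hM
  haveI := (isDomain_away_quotient 𝔮 hx𝔮).1
  rw [IsLocalization.algebraMap_mem_map_algebraMap_iff M.primeCompl]
  rintro ⟨m, hm, hmϖ⟩
  have h0 := (mem_strictTransform_iff _).mp hmϖ
  change Localization.awayMap (Ideal.Quotient.mk 𝔮) x (m.val * algebraMap R (Localization.Away x) ϖ) = 0 at h0
  rw [map_mul, awayMap_algebraMap] at h0
  rcases mul_eq_zero.mp h0 with h | h
  · exact hm (Ideal.mem_sup_left ((mem_strictTransform_iff m).mpr h))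
  · exact hϖ𝔮 ((iota_eq_zero_iff hx𝔮 ϖ).mp h)

end Chart

section Main

variable {R : Type} [CommRing R] [IsRegularLocalRing R]

/-- In `R/𝔭` for a section ideal `𝔭` (`𝔭 + (ϖ) = 𝔪`) the maximal ideal is generated by `ϖ̄`. OURS. -/
theorem maximalIdeal_quotient_eq_span_of_section {ϖ : R} {𝔭 : Ideal R} [𝔭.IsPrime]
    (h𝔭 : 𝔭 ⊔ Ideal.span {ϖ} = maximalIdeal R) :
    haveI : Nontrivial (R ⧸ 𝔭) := Ideal.Quotient.nontrivial_iff.mpr (Ideal.IsPrime.ne_top inferInstance)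
    haveI : IsLocalRing (R ⧸ 𝔭) := .of_surjective' (Ideal.Quotient.mk 𝔭) Ideal.Quotient.mk_surjective
    maximalIdeal (R ⧸ 𝔭) = Ideal.span {Ideal.Quotient.mk 𝔭 ϖ} := by
  haveI : Nontrivial (R ⧸ 𝔭) := Ideal.Quotient.nontrivial_iff.mpr (Ideal.IsPrime.ne_top inferInstance)
  rw [maximalIdeal_quotient_eq_map 𝔭, ← h𝔭, Ideal.map_sup, Ideal.map_span, Set.image_singleton]
  have : Ideal.map (Ideal.Quotient.mk 𝔭) 𝔭 = ⊥ := by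
    rw [Ideal.map_eq_bot_iff_le_ker, Ideal.mk_ker]
  rw [this, bot_sup_eq]

/-- `R/𝔭` is a principal ideal domain (indeed a DVR) for a section ideal `𝔭` with `ϖ ∉ 𝔭`. OURS. -/
theorem isPrincipalIdealRing_quotient_of_section {ϖ : R} {𝔭 : Ideal R} [𝔭.IsPrime]
    (h𝔭 : 𝔭 ⊔ Ideal.span {ϖ} = maximalIdeal R) : IsPrincipalIdealRing (R ⧸ 𝔭) := by
  haveI : Nontrivial (R ⧸ 𝔭) := Ideal.Quotient.nontrivial_iff.mpr (Ideal.IsPrime.ne_top inferInstance)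
  haveI : IsLocalRing (R ⧸ 𝔭) := .of_surjective' (Ideal.Quotient.mk 𝔭) Ideal.Quotient.mk_surjective
  have hmax := maximalIdeal_quotient_eq_span_of_section h𝔭
  have hprinc : (maximalIdeal (R ⧸ 𝔭)).IsPrincipal := ⟨⟨Ideal.Quotient.mk 𝔭 ϖ, by rw [hmax]⟩⟩
  exact ((tfae_of_isNoetherianRing_of_isLocalRing_of_isDomain (R ⧸ 𝔭)).out 4 0).mp hprinc



/-- **Card 1, step (b) (Sketch `StrictTransformOfSection`, VERBATIM).** See the module docstring. OURS. -/
theorem StrictTransformOfSection :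
  ∀ (R : Type) [CommRing R] [IsRegularLocalRing R] (ϖ x : R) (𝔭 𝔮 : Ideal R) (c : ℕ), 𝔭.IsPrime → 𝔮.IsPrime → 𝔭 ≠ 𝔮 →
    ϖ ∈ maximalIdeal R → ϖ ∉ maximalIdeal R ^ 2 → ϖ ∉ 𝔭 → ϖ ∉ 𝔮 →
    𝔭 ⊔ Ideal.span {ϖ} = maximalIdeal R → 𝔮 ⊔ Ideal.span {ϖ} = maximalIdeal R →
    1 ≤ c → 𝔭 ⊔ 𝔮 = 𝔮 ⊔ Ideal.span {ϖ ^ c} → x ∈ 𝔭 → x ∉ 𝔮 → 𝔭 ≤ 𝔮 ⊔ Ideal.span {x} →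
    let S := Literature.AlgebraicGeometry.Resolution.blowupAlgebra 𝔭 x
    let 𝔮' : Ideal S := RingHom.ker ((Localization.awayMap (Ideal.Quotient.mk 𝔮) x).comp S.val.toRingHom)
    Ideal.comap (algebraMap R S) 𝔮' = 𝔮 ∧
    Function.Surjective (fun r : R => Ideal.Quotient.mk 𝔮' (algebraMap R S r)) ∧
    𝔮' ⊔ Ideal.span {algebraMap R S x} = 𝔮' ⊔ Ideal.span {algebraMap R S ϖ ^ c} ∧
    ∃ _ : (𝔮' ⊔ Ideal.span {algebraMap R S ϖ}).IsMaximal,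
      IsRegularLocalRing (Localization.AtPrime (𝔮' ⊔ Ideal.span {algebraMap R S ϖ})) ∧
      algebraMap R (Localization.AtPrime (𝔮' ⊔ Ideal.span {algebraMap R S ϖ})) ϖ ∉
        maximalIdeal (Localization.AtPrime (𝔮' ⊔ Ideal.span {algebraMap R S ϖ})) ^ 2 := by
  intro R _ _ ϖ x 𝔭 𝔮 c h𝔭 h𝔮 hne hϖm hϖ2 hϖ𝔭 hϖ𝔮 h𝔭m h𝔮m hc hcontact hx𝔭 hx𝔮 h𝔭le
  haveI := h𝔭; haveI := h𝔮; haveI := isDomain_of_isRegularLocalRing R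
  -- the centre `R/𝔭` is a discrete valuation ring, so `𝔭` is cut out by a quasi-regular sequence `f` chosen from the
  -- generating set `{x} ∪ (𝔭 ∩ 𝔮)`; since section ideals are incomparable, `x` is one of the `f i`
  haveI : IsPrincipalIdealRing (R ⧸ 𝔭) := isPrincipalIdealRing_quotient_of_section h𝔭m
  haveI : IsRegularLocalRing (R ⧸ 𝔭) := by
    haveI : IsLocalRing (R ⧸ 𝔭) := .of_surjective' (Ideal.Quotient.mk 𝔭) Ideal.Quotient.mk_surjective
    infer_instance
  have h𝔭m' : 𝔭 ≤ maximalIdeal R := by rw [← h𝔭m]; exact le_sup_left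
  have hG : Ideal.span (insert x ((𝔭 ⊓ 𝔮 : Ideal R) : Set R)) = 𝔭 := by
    apply le_antisymm
    · rw [Ideal.span_le]
      rintro y hy
      rcases hy with rfl | hy
      · exact hx𝔭
      · exact hy.1
    · intro p hp
      obtain ⟨q, hq, a, rfl⟩ : ∃ q ∈ 𝔮, ∃ a, q + a * x = p := by
        have := h𝔭le hp
        rw [Submodule.mem_sup] at this
        obtain ⟨q, hq, y, hy, rfl⟩ := this
        obtain ⟨a, rfl⟩ := Ideal.mem_span_singleton'.mp hy
        exact ⟨q, hq, a, rfl⟩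
      have hq𝔭 : q ∈ 𝔭 := by
        have : q + a * x - a * x ∈ 𝔭 := Ideal.sub_mem _ hp (Ideal.mul_mem_left _ _ hx𝔭)
        simpa using this
      rw [Ideal.span_insert]
      exact Ideal.add_mem _ (Ideal.mem_sup_right (Ideal.subset_span ⟨hq𝔭, hq⟩))
        (Ideal.mem_sup_left (Ideal.mem_span_singleton'.mpr ⟨a, rfl⟩))
  obtain ⟨n, f, hfG, hfspan, hfqr, -⟩ :=
    exists_isQuasiRegular_span_eq_of_isRegularLocalRing_quotient h𝔭m' _ hG
  have hi₀ : ∃ i₀, f i₀ = x := by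
    by_contra hnot
    push Not at hnot
    have hall : ∀ i, f i ∈ 𝔮 := fun i => by
      rcases hfG i with h | h
      · exact absurd h (hnot i)
      · exact h.2
    have h𝔭𝔮 : 𝔭 ≤ 𝔮 := by
      rw [← hfspan, Ideal.span_le]
      rintro _ ⟨i, rfl⟩
      exact hall i
    exact hne (eq_of_le_of_section ϖ h𝔭𝔮 hϖ𝔮 h𝔭m)
  obtain ⟨i₀, hi₀⟩ := hi₀
  haveI : IsRegularRing R := isRegularRing_of_isRegularLocalRing R
  haveI : IsRegularRing (R ⧸ Ideal.span (Set.range f)) := by rw [hfspan]; infer_instance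
  have hSreg : IsRegularRing (blowupAlgebra 𝔭 x) := by -- Liu 8.1.19 (a), tree `isRegularRing_blowupAlgebra`
    have h := isRegularRing_blowupAlgebra f i₀ hfqr
    rw [hfspan, hi₀] at h
    exact h
  intro S 𝔮'
  have hM : (𝔮' ⊔ Ideal.span {algebraMap R S ϖ}).IsMaximal := isMaximal_strictTransform_sup h𝔭le hx𝔮 hϖm h𝔮m
  haveI := hM; haveI : IsRegularRing S := hSreg
  haveI hTreg : IsRegularLocalRing (Localization.AtPrime (𝔮' ⊔ Ideal.span {algebraMap R S ϖ})) := inferInstance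
  have c1 : Ideal.comap (algebraMap R S) 𝔮' = 𝔮 := comap_strictTransform hx𝔮
  have c2 : Function.Surjective (fun r : R => Ideal.Quotient.mk 𝔮' (algebraMap R S r)) :=
    surjective_quotient_strictTransform h𝔭le hx𝔮
  have c3 : 𝔮' ⊔ Ideal.span {algebraMap R S x} = 𝔮' ⊔ Ideal.span {algebraMap R S ϖ ^ c} :=
    strictTransform_sup_span_eq hx𝔮 hx𝔭 c hcontact
  refine ⟨c1, c2, c3, hM, hTreg, ?_⟩
  -- `ϖ ∉ 𝔪_T²`: `SectionForcesGoodPoint` for the section `𝔮' T` of `T = S_M`, `M = 𝔮' + (ϖ)`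
  have hsc : algebraMap R (Localization.AtPrime (𝔮' ⊔ Ideal.span {algebraMap R S ϖ})) ϖ =
      algebraMap S (Localization.AtPrime (𝔮' ⊔ Ideal.span {algebraMap R S ϖ})) (algebraMap R S ϖ) :=
    IsScalarTower.algebraMap_apply R S _ ϖ
  have hi : algebraMap R (Localization.AtPrime (𝔮' ⊔ Ideal.span {algebraMap R S ϖ})) ϖ ∉
      𝔮'.map (algebraMap S (Localization.AtPrime (𝔮' ⊔ Ideal.span {algebraMap R S ϖ}))) := by
    rw [hsc]
    exact algebraMap_notMem_map_strictTransform hx𝔮 hϖ𝔮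
  have hii : 𝔮'.map (algebraMap S (Localization.AtPrime (𝔮' ⊔ Ideal.span {algebraMap R S ϖ}))) ⊔
      Ideal.span {algebraMap R (Localization.AtPrime (𝔮' ⊔ Ideal.span {algebraMap R S ϖ})) ϖ} =
        maximalIdeal (Localization.AtPrime (𝔮' ⊔ Ideal.span {algebraMap R S ϖ})) := by
    rw [← Localization.AtPrime.map_eq_maximalIdeal, Ideal.map_sup, Ideal.map_span, Set.image_singleton, ← hsc]
  exact SectionForcesGoodPoint (Localization.AtPrime (𝔮' ⊔ Ideal.span {algebraMap R S ϖ}))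
    (algebraMap R _ ϖ) _ hi hii

end Main

end Summit.ResolutionOfSingularities.ResolutionOfSingularities.Theorems.EquisingularLift.RamifiedCoalescence
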